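import Summits.SmoothPoincare4.SmoothPoincare4.Theorems.InformationMetricHadamardAhHadamardFillingFisherSphereGaussDefs
import Literature.Geometry.Lorentzian.TangentialConnection
import Literature.Geometry.Lorentzian.VolumeProofs

/-!
# The Gauss equation of an isometric immersion into a flat inner product space
(crux `InformationMetricHadamard.AhHadamardFilling`, item stmt-SmoothPoincare4-6014, line `fisher-sphere-gauss`,
stub K2 `stub_hellingerGaussEquation` — the Gauss equation of the Hellinger map). The stub's proof
(`…StubHellingerGaussEquation.lean`) is split by topic into three helper files and the stub file
(tree rule: Theorems files ≤ 400 lines):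
1. `…StubHellingerGaussEquationFamilies.lean` — a jointly smooth family `f : P → K → ℝ` over a
   compact manifold `K` as a `C^∞` map `P → C(K, ℝ)` (differentiation uniformly in `x ∈ K`);
2. `…StubHellingerGaussEquationImmersion.lean` — the Gauss equation of an isometric immersion of a
   manifold into a flat real inner product space, for any torsion-free compatible connection
   (from the tangential Gauss formula of `Literature/Geometry/Lorentzian/TangentialConnection.lean`);
3. `…StubHellingerGaussEquationLpFamily.lean` — the family as a `C^∞` map `W → L²(N, μ)` with
   differential `X ↦ [D1 θ w X]`;
4. `…StubHellingerGaussEquation.lean` — the registered stub.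
Authorship: stub-worker of the line lead prover-line-stmt-SmoothPoincare4-6014-c3-0 (wave 1).

References: J. M. Lee, *Introduction to Riemannian Manifolds* (2nd ed. 2018), Thm. 8.2, Prop. 8.1,
Thm. 8.5 (Gauss formula / equation); J. Dieudonné, *Foundations of Modern Analysis* (1960), (8.11.2);
S. Lang, *Real and Functional Analysis*, XIII §8; D. Groisser, M. K. Murray, dg-ga/9611008, §2.
-/

noncomputable section

-- the prescribed namespace `Summit.<P>.<Sub>.…` duplicates `SmoothPoincare4` (P = Sub)
set_option linter.dupNamespace false

open scoped Manifold ContDiff Topology ENNReal NNReal RealInnerProductSpace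
open Set Function MeasureTheory Topology Filter Bundle

namespace Summit.SmoothPoincare4.SmoothPoincare4.Cruxes.AhHadamardFilling.FisherSphereGauss

/-! ## Part C. The Gauss equation of an isometric immersion into an inner product space -/

section Gauss

open Literature.Geometry.Lorentzian Literature.Geometry.Lorentzian.PseudoRiemannianMetric
open FiberBundle VectorField NormedSpace

variable {E : Type*} [NormedAddCommGroup E] [NormedSpace ℝ E] [FiniteDimensional ℝ E]
  [CompleteSpace E] {H : Type*} [TopologicalSpace H] {I : ModelWithCorners ℝ E H}
  {M : Type*} [TopologicalSpace M] [ChartedSpace H M] [IsManifold I ∞ M]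
  {V : Type*} [NormedAddCommGroup V] [InnerProductSpace ℝ V]
  {g : PseudoRiemannianMetric I ∞ E (TangentSpace I : M → Type _)}
  {cov : CovariantDerivative I E (TangentSpace I : M → Type _)} {ι : M → V}

/-- **Second covariant derivatives of an isometrically immersed manifold, paired with a tangent
vector** (the immersion half of the Gauss equation, Lee 2018, Thm. 8.5, for a `C^∞` map
`ι : M → V` into a real inner product space with `g = ι^*⟨·,·⟩` and any torsion-free
`g`-compatible `cov`). For `Y` of class `C²` and `Z` of class `C³` on an open `u ∋ x` and
`X₀, W₀ ∈ T_x M`: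
`g(∇_{X₀} ∇_Y Z, W₀) = ⟪D_{X₀} D_Y(ι_* Z), dι W₀⟫ + ⟪N(Y, Z)(x), N(X₀, W₀)⟫`, where
`N(Y, Z) = D_Y(ι_* Z) − dι(∇_Y Z)` is the normal part of the ambient derivative (second
fundamental form `II(Y, Z)`) and `N(X₀, W₀)` the normal part of `D_{X₀}(ι_* W)` for the canonical
extension `W` of `W₀`. Proof as for the round sphere (`Riemannian/RoundSphereProofs.lean`,
`val_cov_cov_apply_sphere`): the tangential Gauss formula `IsLeviCivita.inner_mvfderiv_cov_apply`
for `∇_{X₀}(∇_Y Z)`, the splitting `ι_*(∇_Y Z) = D_Y(ι_* Z) − N(Y,Z)`, and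
`⟪D_{X₀} N(Y,Z), dι W₀⟫ = −⟪N(Y,Z), D_{X₀}(ι_* W)⟫` obtained by differentiating
`⟪N(Y,Z), ι_* W⟫ = 0` (Weingarten). [cite: LeeRiemannianManifolds2018, Thm 8.5] -/
theorem val_cov_cov_apply_immersion (h : g.IsLeviCivita cov) (hι : ContMDiff I 𝓘(ℝ, V) ∞ ι)
    (hg : ∀ (y : M) (v w : TangentSpace I y),
      g.val y v w = ⟪mvfderiv I ι y v, mvfderiv I ι y w⟫)
    {x : M} {u : Set M} (hu : IsOpen u) (hxu : x ∈ u)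
    {Y Z : Π y : M, TangentSpace I y} (hY : CMDiff[u] 2 (T% Y)) (hZ : CMDiff[u] 3 (T% Z))
    (X₀ W₀ : TangentSpace I x) :
    g.val x (cov (fun y ↦ cov Z y (Y y)) x X₀) W₀ =
      ⟪mvfderiv I (fun y ↦ mvfderiv I (fun y' ↦ mvfderiv I ι y' (Z y')) y (Y y)) x X₀,
        mvfderiv I ι x W₀⟫
        + ⟪mvfderiv I (fun y' ↦ mvfderiv I ι y' (Z y')) x (Y x) - mvfderiv I ι x (cov Z x (Y x)),
          mvfderiv I (fun y' ↦ mvfderiv I ι y' (extend E W₀ y')) x X₀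
            - mvfderiv I ι x (cov (extend E W₀) x X₀)⟫ := by
  have hnh : ∀ {y}, y ∈ u → u ∈ 𝓝 y := fun hy ↦ hu.mem_nhds hy
  have h23 : (2 : ℕ∞ω) ≤ 3 := by norm_num
  have h12 : (1 : ℕ∞ω) ≤ 2 := by norm_num
  have h2i : (2 : ℕ∞ω) ≤ (∞ : ℕ∞ω) := WithTop.coe_le_coe.mpr le_top
  have h21 : (2 : ℕ∞ω) + 1 ≤ (∞ : ℕ∞ω) := WithTop.coe_le_coe.mpr le_top
  have h11 : (1 : ℕ∞ω) + 1 ≤ (∞ : ℕ∞ω) := WithTop.coe_le_coe.mpr le_top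
  haveI : Fact ((1 : ℕ∞ω) ≤ (∞ : ℕ∞ω)) := ⟨le_trans h12 h2i⟩
  -- regularity of `cov`: locally `C²`
  have hreg2 : cov.IsLocallyContMDiff 2 := h.isLocallyContMDiff 2 h21
  -- the second-order field `∇_Y Z` is `C²` on `u`
  set U : Π y : M, TangentSpace I y := fun y ↦ cov Z y (Y y) with hUdef
  have hTZ : ContMDiffOn I (I.prod 𝓘(ℝ, E →L[ℝ] E)) 2 (cov.totalCovDeriv Z) u :=
    (hreg2 u hu).contMDiff hZ
  have hU2 : CMDiff[u] 2 (T% U) := hTZ.clm_bundle_apply hY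
  have hUx : CMDiffAt 2 (T% U) x := (hU2 x hxu).contMDiffAt (hnh hxu)
  -- pointwise regularity on `u`
  have hY2 : ∀ {y}, y ∈ u → CMDiffAt 2 (T% Y) y := fun hy ↦ (hY _ hy).contMDiffAt (hnh hy)
  have hZ2 : ∀ {y}, y ∈ u → CMDiffAt 2 (T% Z) y := fun hy ↦
    ((hZ _ hy).contMDiffAt (hnh hy)).of_le h23
  -- the lift `ι_* Z` and its regularity
  set LZ : M → V := fun y ↦ mvfderiv I ι y (Z y) with hLZdef
  have hLZ2 : ∀ {y}, y ∈ u → ContMDiffAt I 𝓘(ℝ, V) 2 LZ y := fun hy ↦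
    VectorField.contMDiffAt_mvfderiv_apply_of_contMDiffAt (hι _) (hZ2 hy) h21
  -- `G y := d(ι_* Z)_y (Y y)` is differentiable at `x`
  set G : M → V := fun y ↦ mvfderiv I LZ y (Y y) with hGdef
  have hGd : MDifferentiableAt I 𝓘(ℝ, V) G x :=
    (VectorField.contMDiffAt_mvfderiv_apply_of_contMDiffAt (hLZ2 hxu) ((hY2 hxu).of_le h12)
      (by norm_num)).mdifferentiableAt one_ne_zero
  -- the lift `ι_* U` of `U = ∇_Y Z` is differentiable at `x`
  set LU : M → V := fun y ↦ mvfderiv I ι y (U y) with hLUdef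
  have hLUd : MDifferentiableAt I 𝓘(ℝ, V) LU x :=
    (VectorField.contMDiffAt_mvfderiv_apply_of_contMDiffAt (hι x) (hUx.of_le h12)
      h11).mdifferentiableAt one_ne_zero
  -- the normal field `Nf = D_Y(ι_* Z) - ι_*(∇_Y Z)`
  set Nf : M → V := fun y ↦ G y - LU y with hNfdef
  have hNfd : MDifferentiableAt I 𝓘(ℝ, V) Nf x := hGd.sub hLUd
  -- `Nf` is normal on `u` (tangential Gauss formula)
  have hNn : ∀ {y}, y ∈ u → ∀ w : TangentSpace I y, ⟪Nf y, mvfderiv I ι y w⟫ = 0 := by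
    intro y hy w
    have hA := h.inner_mvfderiv_cov_apply (hι.of_le h2i) hg (hZ2 hy) (Y y) w
    simp only [hNfdef, hGdef, hLUdef, hUdef, hLZdef, inner_sub_left]
    rw [hA, sub_self]
  -- the lift `ι_* W` of the extension `W` of `W₀`
  set LW : M → V := fun y ↦ mvfderiv I ι y (extend E W₀ y) with hLWdef
  have hLWd : MDifferentiableAt I 𝓘(ℝ, V) LW x :=
    (VectorField.contMDiffAt_mvfderiv_apply_of_contMDiffAt (hι x)
      (contMDiffAt_extend (I := I) (F := E) (k := 1) W₀) h11).mdifferentiableAt one_ne_zero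
  have hLWx : LW x = mvfderiv I ι x W₀ := by simp [hLWdef]
  -- Weingarten: `⟪D_{X₀} Nf, dι W₀⟫ = -⟪Nf x, D_{X₀}(ι_* W)⟫`
  have hs0 : (fun y ↦ ⟪Nf y, LW y⟫) =ᶠ[𝓝 x] fun _ ↦ (0 : ℝ) := by
    filter_upwards [hnh hxu] with y hy
    exact hNn hy _
  have hds : mvfderiv I (fun y ↦ ⟪Nf y, LW y⟫) x X₀ = 0 := by
    rw [mvfderiv_congr_nhds hs0, mvfderiv_const]; rfl
  have hprod := mvfderiv_inner_apply hNfd hLWd X₀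
  rw [hds, hLWx] at hprod
  -- the tangential Gauss formula for `∇_{X₀} U`
  have hA := h.inner_mvfderiv_cov_apply (hι.of_le h2i) hg hUx X₀ W₀
  rw [hg, hA]
  have hLU_eq : (fun y ↦ mvfderiv I ι y (U y)) = G - Nf := by
    funext y; simp [hNfdef, hLUdef]
  rw [hLU_eq, mvfderiv_sub hGd hNfd]
  have hn1 : ⟪Nf x, mvfderiv I ι x (cov (extend E W₀) x X₀)⟫ = 0 := hNn hxu _
  have hNfx : Nf x = mvfderiv I LZ x (Y x) - mvfderiv I ι x (cov Z x (Y x)) := rfl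
  rw [← hNfx, inner_sub_right (Nf x), hn1, sub_zero]
  simp only [sub_apply, inner_sub_left]
  linarith

/-- **The Gauss equation of an isometric immersion into a flat inner product space** (Gauss 1827;
Lee 2018, Thm. 8.5 with `R̃m = 0`): for `ι : M → V` of class `C^∞` with `g = ι^*⟨·,·⟩` and
any torsion-free `g`-compatible `cov`, the curvature tensor (`CovariantDerivative.curvature`,
`R(X,Y)Z = ∇_X ∇_Y Z − ∇_Y ∇_X Z − ∇_{[X,Y]} Z`) satisfies
`g(R(X₀,Y₀)Z₀, W₀) = ⟪II(Y₀,Z₀), II(X₀,W₀)⟫ − ⟪II(X₀,Z₀), II(Y₀,W₀)⟫`, where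
`II(A₀, B₀) = D_{A₀}(ι_* B) − dι(∇_{A₀} B) ∈ V` is the normal part of the ambient derivative of
the canonical extension `B` of `B₀` (the second fundamental form). Proof as for the round sphere
(`curvature_roundMetric`): evaluate `R` on the canonical extensions
(`curvature_apply_of_isLocallyContMDiff`), expand the two second-order terms by
`val_cov_cov_apply_immersion` and the bracket term by the tangential Gauss formula and
`mvfderiv_apply_mlieBracket_vec`; the ambient second derivatives cancel.
[cite: LeeRiemannianManifolds2018, Thm 8.5] -/
theorem val_curvature_immersion (h : g.IsLeviCivita cov) (hι : ContMDiff I 𝓘(ℝ, V) ∞ ι)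
    (hg : ∀ (y : M) (v w : TangentSpace I y),
      g.val y v w = ⟪mvfderiv I ι y v, mvfderiv I ι y w⟫)
    (x : M) (X₀ Y₀ Z₀ W₀ : TangentSpace I x) :
    g.val x (cov.curvature x X₀ Y₀ Z₀) W₀ =
      ⟪mvfderiv I (fun y ↦ mvfderiv I ι y (extend E Z₀ y)) x Y₀
          - mvfderiv I ι x (cov (extend E Z₀) x Y₀),
        mvfderiv I (fun y ↦ mvfderiv I ι y (extend E W₀ y)) x X₀
          - mvfderiv I ι x (cov (extend E W₀) x X₀)⟫
      - ⟪mvfderiv I (fun y ↦ mvfderiv I ι y (extend E Z₀ y)) x X₀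
          - mvfderiv I ι x (cov (extend E Z₀) x X₀),
        mvfderiv I (fun y ↦ mvfderiv I ι y (extend E W₀ y)) x Y₀
          - mvfderiv I ι x (cov (extend E W₀) x Y₀)⟫ := by
  have hI3 : IsManifold I (minSmoothness ℝ 3) M := by
    rw [minSmoothness_of_isRCLikeNormedField]; infer_instance
  have h2m : minSmoothness ℝ 2 = 2 := minSmoothness_of_isRCLikeNormedField
  have h2i : (2 : ℕ∞ω) ≤ (∞ : ℕ∞ω) := WithTop.coe_le_coe.mpr le_top
  have h3i : (3 : ℕ∞ω) ≤ (∞ : ℕ∞ω) := WithTop.coe_le_coe.mpr le_top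
  have h21 : (2 : ℕ∞ω) + 1 ≤ (∞ : ℕ∞ω) := WithTop.coe_le_coe.mpr le_top
  have h23 : (2 : ℕ∞ω) ≤ 3 := by norm_num
  -- smooth local extensions of the three vectors, on a common open set `u ∋ x`
  obtain ⟨uX, huX, hxX, hXs⟩ := exists_isOpen_contMDiffOn_extend_infty (I := I) X₀
  obtain ⟨uY, huY, hxY, hYs⟩ := exists_isOpen_contMDiffOn_extend_infty (I := I) Y₀
  obtain ⟨uZ, huZ, hxZ, hZs⟩ := exists_isOpen_contMDiffOn_extend_infty (I := I) Z₀
  set X : Π y : M, TangentSpace I y := extend E X₀ with hXdef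
  set Y : Π y : M, TangentSpace I y := extend E Y₀ with hYdef
  set Z : Π y : M, TangentSpace I y := extend E Z₀ with hZdef
  set u : Set M := uX ∩ uY ∩ uZ with hudef
  have hu : IsOpen u := (huX.inter huY).inter huZ
  have hxu : x ∈ u := ⟨⟨hxX, hxY⟩, hxZ⟩
  have hnh : u ∈ 𝓝 x := hu.mem_nhds hxu
  have hX2 : CMDiff[u] 2 (T% X) := (hXs.of_le h2i).mono fun y hy ↦ hy.1.1
  have hY2 : CMDiff[u] 2 (T% Y) := (hYs.of_le h2i).mono fun y hy ↦ hy.1.2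
  have hZ3 : CMDiff[u] 3 (T% Z) := (hZs.of_le h3i).mono fun y hy ↦ hy.2
  have hXx2 : CMDiffAt 2 (T% X) x := (hX2 x hxu).contMDiffAt hnh
  have hYx2 : CMDiffAt 2 (T% Y) x := (hY2 x hxu).contMDiffAt hnh
  have hZx2 : CMDiffAt 2 (T% Z) x := ((hZ3 x hxu).contMDiffAt hnh).of_le h23
  have hXx : X x = X₀ := extend_apply_self _ X₀
  have hYx : Y x = Y₀ := extend_apply_self _ Y₀
  have hZx : Z x = Z₀ := extend_apply_self _ Z₀
  -- Step 1: the curvature tensor is computed on the extensions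
  have hreg1 : cov.IsLocallyContMDiff 1 := h.isLocallyContMDiff_one h2i
  have e1 : cov.curvature x X₀ Y₀ Z₀ = CovariantDerivative.curvatureAux cov X Y Z x := by
    have hZm : CMDiffAt (minSmoothness ℝ 2) (T% Z) x := by rw [h2m]; exact hZx2
    have := cov.curvature_apply_of_isLocallyContMDiff hreg1 (hXx2.mdifferentiableAt two_ne_zero)
      (hYx2.mdifferentiableAt two_ne_zero) hZm
    rwa [hXx, hYx, hZx] at this
  rw [e1]
  simp only [CovariantDerivative.curvatureAux, map_sub, sub_apply]
  -- Step 2: the two second-order terms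
  rw [val_cov_cov_apply_immersion h hι hg hu hxu hY2 hZ3 (X x) W₀,
    val_cov_cov_apply_immersion h hι hg hu hxu hX2 hZ3 (Y x) W₀]
  -- Step 3: the bracket term
  have hLZ2 : ContMDiffAt I 𝓘(ℝ, V) 2 (fun y ↦ mvfderiv I ι y (Z y)) x :=
    VectorField.contMDiffAt_mvfderiv_apply_of_contMDiffAt (hι x) hZx2 h21
  have hA := h.inner_mvfderiv_cov_apply (hι.of_le h2i) hg hZx2 (mlieBracket I X Y x) W₀
  have hB := mvfderiv_apply_mlieBracket_vec (I := I) hLZ2 hXx2 hYx2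
  have h3 : g.val x (cov Z x (mlieBracket I X Y x)) W₀ =
      ⟪mvfderiv I (fun y ↦ mvfderiv I (fun y' ↦ mvfderiv I ι y' (Z y')) y (Y y)) x (X x),
          mvfderiv I ι x W₀⟫
        - ⟪mvfderiv I (fun y ↦ mvfderiv I (fun y' ↦ mvfderiv I ι y' (Z y')) y (X y)) x (Y x),
          mvfderiv I ι x W₀⟫ := by
    rw [hg, hA, hB, inner_sub_left]
  rw [h3, hXx, hYx]
  ring

/-- **The second fundamental form of an isometric immersion is symmetric**:
`D_{A₀}(ι_* B) − dι(∇_{A₀} B) = D_{B₀}(ι_* A) − dι(∇_{B₀} A)` for the canonical extensions `A`,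
`B` of `A₀, B₀ ∈ T_x M` — the difference is `dι([A, B]_x) − dι(∇_{A₀} B − ∇_{B₀} A) = 0` by the
naturality of the bracket (`mvfderiv_apply_mlieBracket_vec`) and torsion-freeness (Lee 2018,
Prop. 8.1). [cite: LeeRiemannianManifolds2018, Prop. 8.1] -/
theorem sff_symm_immersion (h : g.IsLeviCivita cov) (hι : ContMDiff I 𝓘(ℝ, V) ∞ ι) (x : M)
    (A₀ B₀ : TangentSpace I x) :
    mvfderiv I (fun y ↦ mvfderiv I ι y (extend E B₀ y)) x A₀ - mvfderiv I ι x (cov (extend E B₀) x A₀) =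
      mvfderiv I (fun y ↦ mvfderiv I ι y (extend E A₀ y)) x B₀
        - mvfderiv I ι x (cov (extend E A₀) x B₀) := by
  have h2i : (2 : ℕ∞ω) ≤ (∞ : ℕ∞ω) := WithTop.coe_le_coe.mpr le_top
  set X : Π y : M, TangentSpace I y := extend E A₀ with hXdef
  set Y : Π y : M, TangentSpace I y := extend E B₀ with hYdef
  have hX : CMDiffAt 2 (T% X) x := contMDiffAt_extend (I := I) (F := E) A₀
  have hY : CMDiffAt 2 (T% Y) x := contMDiffAt_extend (I := I) (F := E) B₀
  have hXx : X x = A₀ := extend_apply_self _ A₀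
  have hYx : Y x = B₀ := extend_apply_self _ B₀
  have htor : cov Y x (X x) - cov X x (Y x) = mlieBracket I X Y x :=
    (CovariantDerivative.torsion_eq_zero_iff cov).1 h.1 (mdifferentiableAt_extend ..)
      (mdifferentiableAt_extend ..)
  have hB := mvfderiv_apply_mlieBracket_vec (I := I) ((hι.of_le h2i) x) hX hY
  rw [hXx, hYx] at hB htor
  have hd : mvfderiv I ι x (cov Y x A₀) - mvfderiv I ι x (cov X x B₀) =
      mvfderiv I ι x (mlieBracket I X Y x) := by
    rw [← map_sub, htor]
  rw [sub_eq_sub_iff_sub_eq_sub, hd, hB]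

/-- **The second fundamental form is normal**: `⟪D_{A₀}(ι_* B) − dι(∇_{A₀} B), dι W₀⟫ = 0`
(the tangential Gauss formula `IsLeviCivita.inner_mvfderiv_cov_apply` on the canonical extension
`B` of `B₀`; Lee 2018, Thm. 8.2). [cite: LeeRiemannianManifolds2018, Thm 8.2] -/
theorem inner_sff_mvfderiv_immersion (h : g.IsLeviCivita cov) (hι : ContMDiff I 𝓘(ℝ, V) ∞ ι)
    (hg : ∀ (y : M) (v w : TangentSpace I y),
      g.val y v w = ⟪mvfderiv I ι y v, mvfderiv I ι y w⟫)
    (x : M) (A₀ B₀ W₀ : TangentSpace I x) :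
    ⟪mvfderiv I (fun y ↦ mvfderiv I ι y (extend E B₀ y)) x A₀ - mvfderiv I ι x (cov (extend E B₀) x A₀),
      mvfderiv I ι x W₀⟫ = 0 := by
  have h2i : (2 : ℕ∞ω) ≤ (∞ : ℕ∞ω) := WithTop.coe_le_coe.mpr le_top
  have hA := h.inner_mvfderiv_cov_apply (hι.of_le h2i) hg
    (contMDiffAt_extend (I := I) (F := E) B₀) A₀ W₀
  rw [inner_sub_left, hA, sub_self]

end Gauss

end Summit.SmoothPoincare4.SmoothPoincare4.Cruxes.AhHadamardFilling.FisherSphereGauss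

end
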